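import Literature.Geometry.Lorentzian.KerrIngoingCoordConnectionII
import HarnessLib

/-!
# The Kerr metric in ingoing Kerr coordinates `(t*, r, μ, φ)`, VIIb: lowered curvature, pairs `02`,
`03`

Infrastructure (all results proved) for the curvature invariants of the Kerr metric, continuing
`KerrIngoingCoordConnection{,II}.lean`: the **components of the curvature tensor with all indices
down**, `g(R(∂_A, ∂_C)∂_j, ∂_d)` (`A < C`, `j < d`; the others by skew-symmetry), for the component
field `Kerr.Ingoing.bilin M a` (`MetricCoord.riemAt`, convention `R(X,Y) = [∇_X, ∇_Y] − ∇_{[X,Y]}`),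
in closed form (rational in `r, μ`, denominators `Σ³`, `Σ³(1 − μ²)`, …), on the regular set `{Σ ≠ 0,
μ² ≠ 1}`. Each entry comes from the first-kind formula `g(R(X,Y)Z, W) = ½(∂_X K(Y,Z,W) − ∂_Y
K(X,Z,W)) − g(Γ(Y,Z), Γ(X,W)) + g(Γ(X,Z), Γ(Y,W))` (`MetricCoord.IsMetricOn.apply_riemAt`; O'Neill
1983, Ch. 3, Lemma 3.38) with the closed-form Koszul derivatives
(`KerrIngoingCoordChristoffel.lean`) and Christoffel symbols (`Kerr.Ingoing.chrAt_bv_ij`), and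
`field_simp`/`ring` (every entry independently; the pair symmetry `g(R(∂_A,∂_C)∂_j, ∂_d) =
g(R(∂_j,∂_d)∂_A, ∂_C)`, O'Neill 1983, Ch. 3, Prop. 3.36, is visible in the closed forms). The closed
forms were generated by computer algebra (exact rational arithmetic over `ℚ(r, μ, M, a)`) and are
checked here by Lean; nothing is taken on trust. Exponents are written `^ (n : ℕ)` in the generated
expressions: fixing the exponent type up front keeps their elaboration fast. This file: the pairs
`(∂_0, ∂_3)`, `(∂_1, ∂_2)`.

## References

* R. P. Kerr, Phys. Rev. Lett. 11 (1963) 237–238; R. P. Kerr, A. Schild, *A new class of vacuum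
  solutions of the Einstein field equations* (1965), §3.
* B. O'Neill, *Semi-Riemannian geometry* (1983), Ch. 3, Prop. 3.13, Lemma 3.38, Prop. 3.36.
* M. Visser, *The Kerr spacetime: a brief introduction*, arXiv:0706.0622, (E:K1)–(E:K2).
* R. C. Henry, *Kretschmann scalar for a Kerr–Newman black hole*, Astrophys. J. 535 (2000) 350.
-/

noncomputable section

set_option maxSynthPendingDepth 3

open Set Function Module
open scoped ContDiff Topology
open Literature.Geometry.Lorentzian.MetricCoord

namespace Literature.Geometry.Lorentzian

namespace Kerr

namespace Ingoing

variable (M a : ℝ) {u : E4}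

/-! ### The entries, pair `(∂_0, ∂_3)` -/

/-- **`g(R(∂_0,∂_3)∂_0, ∂_1)`** for the Kerr components (lowered curvature component, closed form).
[cite: KerrSchild1965, §3] -/
theorem rlow_03_01 (hu : u ∈ regularSet a) :
    bilin M a u (riemAt (bilin M a) u (E4.basisVector 0) (E4.basisVector 3) (E4.basisVector 0))
      (E4.basisVector 1) = (3 * u 1 * u 2 ^ (4 : ℕ) * M * a ^ (3 : ℕ) -
        3 * u 1 * u 2 ^ (2 : ℕ) * M * a ^ (3 : ℕ) - u 1 ^ (3 : ℕ) * u 2 ^ (2 : ℕ) * M * a +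
        u 1 ^ (3 : ℕ) * M * a) / sigma a u ^ (3 : ℕ) := by
  have hS := hu.1
  have hP := hu.2
  rw [(isMetricOn_bilin M a).apply_riemAt hu]
  simp only [koszulCLM_eq_koszulForm, fderiv_koszulForm_bilin M a hu, bilin_apply,
    chrAt_bv_00 M a hu, chrAt_bv_01 M a hu, chrAt_bv_03 M a hu, chrAt_bv_13 M a hu,
    (isMetricOn_bilin M a).chrAt_comm hu (E4.basisVector 3) (E4.basisVector 0),
    (isMetricOn_bilin M a).chrAt_comm hu (E4.basisVector 3) (E4.basisVector 1)]
  simp only [dKoszulR, dKoszulM, bilinRR_apply, bilinRM_apply, bilinMM_apply, bv_apply,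
    Fin.isValue, Fin.reduceEq, if_true, if_false, Matrix.cons_val_zero, Matrix.cons_val_one,
    Matrix.cons_val, mul_one, one_mul, mul_zero, zero_mul, add_zero, zero_add, sub_zero, zero_sub]
  simp only [h00, h03, c13, c22, c33, scalarH]
  field_simp
  simp only [sigma, sinSq]
  ring

/-- **`g(R(∂_0,∂_3)∂_0, ∂_2)`** for the Kerr components (lowered curvature component, closed form).
[cite: KerrSchild1965, §3] -/
theorem rlow_03_02 (hu : u ∈ regularSet a) :
    bilin M a u (riemAt (bilin M a) u (E4.basisVector 0) (E4.basisVector 3) (E4.basisVector 0))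
      (E4.basisVector 2) = 0 := by
  have hS := hu.1
  have hP := hu.2
  rw [(isMetricOn_bilin M a).apply_riemAt hu]
  simp only [koszulCLM_eq_koszulForm, fderiv_koszulForm_bilin M a hu, bilin_apply,
    chrAt_bv_00 M a hu, chrAt_bv_02 M a hu, chrAt_bv_03 M a hu, chrAt_bv_23 M a hu,
    (isMetricOn_bilin M a).chrAt_comm hu (E4.basisVector 3) (E4.basisVector 0),
    (isMetricOn_bilin M a).chrAt_comm hu (E4.basisVector 3) (E4.basisVector 2)]
  simp only [dKoszulR, dKoszulM, bilinRR_apply, bilinRM_apply, bilinMM_apply, bv_apply,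
    Fin.isValue, Fin.reduceEq, if_true, if_false, Matrix.cons_val_zero, Matrix.cons_val_one,
    Matrix.cons_val, mul_one, one_mul, mul_zero, zero_mul, add_zero, zero_add, sub_zero, zero_sub]
  simp only [h00, h03, c13, c33, scalarH]
  field_simp
  simp only [sigma, sinSq]
  ring

/-- **`g(R(∂_0,∂_3)∂_0, ∂_3)`** for the Kerr components (lowered curvature component, closed form).
[cite: KerrSchild1965, §3] -/
theorem rlow_03_03 (hu : u ∈ regularSet a) :
    bilin M a u (riemAt (bilin M a) u (E4.basisVector 0) (E4.basisVector 3) (E4.basisVector 0))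
      (E4.basisVector 3) = (-(3 * u 1 * u 2 ^ (4 : ℕ) * M * a ^ (4 : ℕ)) +
        6 * u 1 ^ (2 : ℕ) * u 2 ^ (4 : ℕ) * M ^ (2 : ℕ) * a ^ (2 : ℕ) -
        3 * u 1 ^ (3 : ℕ) * u 2 ^ (4 : ℕ) * M * a ^ (2 : ℕ) +
        3 * u 1 * u 2 ^ (2 : ℕ) * M * a ^ (4 : ℕ) -
        6 * u 1 ^ (2 : ℕ) * u 2 ^ (2 : ℕ) * M ^ (2 : ℕ) * a ^ (2 : ℕ) +
        4 * u 1 ^ (3 : ℕ) * u 2 ^ (2 : ℕ) * M * a ^ (2 : ℕ) -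
        2 * u 1 ^ (4 : ℕ) * u 2 ^ (2 : ℕ) * M ^ (2 : ℕ) + u 1 ^ (5 : ℕ) * u 2 ^ (2 : ℕ) * M -
        u 1 ^ (3 : ℕ) * M * a ^ (2 : ℕ) + 2 * u 1 ^ (4 : ℕ) * M ^ (2 : ℕ) -
        u 1 ^ (5 : ℕ) * M) / sigma a u ^ (3 : ℕ) := by
  have hS := hu.1
  have hP := hu.2
  rw [(isMetricOn_bilin M a).apply_riemAt hu]
  simp only [koszulCLM_eq_koszulForm, fderiv_koszulForm_bilin M a hu, bilin_apply,
    chrAt_bv_00 M a hu, chrAt_bv_03 M a hu, chrAt_bv_33 M a hu,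
    (isMetricOn_bilin M a).chrAt_comm hu (E4.basisVector 3) (E4.basisVector 0)]
  simp only [dKoszulR, dKoszulM, bilinRR_apply, bilinRM_apply, bilinMM_apply, bv_apply,
    Fin.isValue, Fin.reduceEq, if_true, if_false, Matrix.cons_val_zero, Matrix.cons_val_one,
    Matrix.cons_val, mul_one, mul_zero, zero_mul, add_zero, zero_add, sub_zero, zero_sub]
  simp only [h00, h03, c13, c22, c33, scalarH]
  field_simp
  simp only [sigma, sinSq]
  ring

/-- **`g(R(∂_0,∂_3)∂_1, ∂_2)`** for the Kerr components (lowered curvature component, closed form).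
[cite: KerrSchild1965, §3] -/
theorem rlow_03_12 (hu : u ∈ regularSet a) :
    bilin M a u (riemAt (bilin M a) u (E4.basisVector 0) (E4.basisVector 3) (E4.basisVector 1))
      (E4.basisVector 2) = (u 2 ^ (3 : ℕ) * M * a ^ (3 : ℕ) -
        3 * u 1 ^ (2 : ℕ) * u 2 * M * a) / sigma a u ^ (2 : ℕ) := by
  have hS := hu.1
  have hP := hu.2
  rw [(isMetricOn_bilin M a).apply_riemAt hu]
  simp only [koszulCLM_eq_koszulForm, fderiv_koszulForm_bilin M a hu, bilin_apply,
    chrAt_bv_01 M a hu, chrAt_bv_02 M a hu, chrAt_bv_13 M a hu, chrAt_bv_23 M a hu,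
    (isMetricOn_bilin M a).chrAt_comm hu (E4.basisVector 3) (E4.basisVector 1),
    (isMetricOn_bilin M a).chrAt_comm hu (E4.basisVector 3) (E4.basisVector 2)]
  simp only [dKoszulR, dKoszulM, bilinRR_apply, bilinRM_apply, bilinMM_apply, bv_apply,
    Fin.isValue, Fin.reduceEq, if_true, if_false, Matrix.cons_val_zero, Matrix.cons_val_one,
    Matrix.cons_val, mul_one, one_mul, mul_zero, zero_mul, add_zero, zero_add, sub_zero, zero_sub]
  simp only [h00, h03, c13, c33, scalarH]
  field_simp
  simp only [sigma, sinSq]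
  ring

/-- **`g(R(∂_0,∂_3)∂_1, ∂_3)`** for the Kerr components (lowered curvature component, closed form).
[cite: KerrSchild1965, §3] -/
theorem rlow_03_13 (hu : u ∈ regularSet a) :
    bilin M a u (riemAt (bilin M a) u (E4.basisVector 0) (E4.basisVector 3) (E4.basisVector 1))
      (E4.basisVector 3) = (6 * u 1 ^ (2 : ℕ) * u 2 ^ (4 : ℕ) * M ^ (2 : ℕ) * a ^ (2 : ℕ) -
        6 * u 1 ^ (2 : ℕ) * u 2 ^ (2 : ℕ) * M ^ (2 : ℕ) * a ^ (2 : ℕ) -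
        2 * u 1 ^ (4 : ℕ) * u 2 ^ (2 : ℕ) * M ^ (2 : ℕ) +
        2 * u 1 ^ (4 : ℕ) * M ^ (2 : ℕ)) / sigma a u ^ (3 : ℕ) := by
  have hS := hu.1
  have hP := hu.2
  rw [(isMetricOn_bilin M a).apply_riemAt hu]
  simp only [koszulCLM_eq_koszulForm, fderiv_koszulForm_bilin M a hu, bilin_apply,
    chrAt_bv_01 M a hu, chrAt_bv_03 M a hu, chrAt_bv_13 M a hu, chrAt_bv_33 M a hu,
    (isMetricOn_bilin M a).chrAt_comm hu (E4.basisVector 3) (E4.basisVector 1)]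
  simp only [dKoszulR, dKoszulM, bilinRR_apply, bilinRM_apply, bilinMM_apply, bv_apply,
    Fin.isValue, Fin.reduceEq, if_true, if_false, Matrix.cons_val_zero, Matrix.cons_val_one,
    Matrix.cons_val, mul_one, one_mul, mul_zero, zero_mul, add_zero, zero_add, sub_zero, zero_sub]
  simp only [h00, h03, c13, c22, c33, scalarH]
  field_simp
  simp only [sigma, sinSq]
  ring

/-- **`g(R(∂_0,∂_3)∂_2, ∂_3)`** for the Kerr components (lowered curvature component, closed form).
[cite: KerrSchild1965, §3] -/
theorem rlow_03_23 (hu : u ∈ regularSet a) :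
    bilin M a u (riemAt (bilin M a) u (E4.basisVector 0) (E4.basisVector 3) (E4.basisVector 2))
      (E4.basisVector 3) = 0 := by
  have hS := hu.1
  have hP := hu.2
  rw [(isMetricOn_bilin M a).apply_riemAt hu]
  simp only [koszulCLM_eq_koszulForm, fderiv_koszulForm_bilin M a hu, bilin_apply,
    chrAt_bv_02 M a hu, chrAt_bv_03 M a hu, chrAt_bv_23 M a hu, chrAt_bv_33 M a hu,
    (isMetricOn_bilin M a).chrAt_comm hu (E4.basisVector 3) (E4.basisVector 2)]
  simp only [dKoszulR, dKoszulM, bilinRR_apply, bilinRM_apply, bilinMM_apply, bv_apply,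
    Fin.isValue, Fin.reduceEq, if_true, if_false, Matrix.cons_val_zero, Matrix.cons_val_one,
    Matrix.cons_val, mul_one, one_mul, mul_zero, zero_mul, add_zero, zero_add, sub_zero, zero_sub]
  simp only [h00, h03, c13, c33, scalarH]
  field_simp
  simp only [sigma, sinSq]
  ring

/-! ### The entries, pair `(∂_1, ∂_2)` -/

/-- **`g(R(∂_1,∂_2)∂_0, ∂_1)`** for the Kerr components (lowered curvature component, closed form).
[cite: KerrSchild1965, §3] -/
theorem rlow_12_01 (hu : u ∈ regularSet a) :
    bilin M a u (riemAt (bilin M a) u (E4.basisVector 1) (E4.basisVector 2) (E4.basisVector 0))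
      (E4.basisVector 1) = (-(3 * u 2 ^ (3 : ℕ) * M * a ^ (4 : ℕ)) +
        9 * u 1 ^ (2 : ℕ) * u 2 * M * a ^ (2 : ℕ)) / sigma a u ^ (3 : ℕ) := by
  have hS := hu.1
  have hP := hu.2
  rw [(isMetricOn_bilin M a).apply_riemAt hu]
  simp only [koszulCLM_eq_koszulForm, fderiv_koszulForm_bilin M a hu, bilin_apply,
    chrAt_bv_01 M a hu, chrAt_bv_02 M a hu, chrAt_bv_11 M a hu, chrAt_bv_12 M a hu,
    (isMetricOn_bilin M a).chrAt_comm hu (E4.basisVector 1) (E4.basisVector 0),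
    (isMetricOn_bilin M a).chrAt_comm hu (E4.basisVector 2) (E4.basisVector 0),
    (isMetricOn_bilin M a).chrAt_comm hu (E4.basisVector 2) (E4.basisVector 1)]
  simp only [dKoszulR, dKoszulM, bilinRR_apply, bilinRM_apply, bilinMM_apply, bv_apply,
    Fin.isValue, Fin.reduceEq, if_true, if_false, Matrix.cons_val_zero, Matrix.cons_val_one,
    Matrix.cons_val, mul_one, one_mul, mul_zero, zero_mul, add_zero, zero_add, sub_zero]
  simp only [h00, h03, c13, c22, c33, h00rm, scalarH, scalarHrm]
  field_simp
  simp only [sigma, sinSq]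
  ring

/-- **`g(R(∂_1,∂_2)∂_0, ∂_2)`** for the Kerr components (lowered curvature component, closed form).
[cite: KerrSchild1965, §3] -/
theorem rlow_12_02 (hu : u ∈ regularSet a) :
    bilin M a u (riemAt (bilin M a) u (E4.basisVector 1) (E4.basisVector 2) (E4.basisVector 0))
      (E4.basisVector 2) = (-(9 * u 1 * u 2 ^ (4 : ℕ) * M * a ^ (4 : ℕ)) +
        9 * u 1 * u 2 ^ (2 : ℕ) * M * a ^ (4 : ℕ) -
        6 * u 1 ^ (2 : ℕ) * u 2 ^ (2 : ℕ) * M ^ (2 : ℕ) * a ^ (2 : ℕ) +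
        3 * u 1 ^ (3 : ℕ) * u 2 ^ (2 : ℕ) * M * a ^ (2 : ℕ) -
        3 * u 1 ^ (3 : ℕ) * M * a ^ (2 : ℕ) +
        2 * u 1 ^ (4 : ℕ) * M ^ (2 : ℕ)) / (sigma a u ^ (3 : ℕ) * sinSq u) := by
  have hS := hu.1
  have hP := hu.2
  rw [(isMetricOn_bilin M a).apply_riemAt hu]
  simp only [koszulCLM_eq_koszulForm, fderiv_koszulForm_bilin M a hu, bilin_apply,
    chrAt_bv_01 M a hu, chrAt_bv_02 M a hu, chrAt_bv_12 M a hu, chrAt_bv_22 M a hu,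
    (isMetricOn_bilin M a).chrAt_comm hu (E4.basisVector 1) (E4.basisVector 0),
    (isMetricOn_bilin M a).chrAt_comm hu (E4.basisVector 2) (E4.basisVector 0)]
  simp only [dKoszulR, dKoszulM, bilinRR_apply, bilinRM_apply, bilinMM_apply, bv_apply,
    Fin.isValue, Fin.reduceEq, if_true, if_false, Matrix.cons_val_zero, Matrix.cons_val_one,
    Matrix.cons_val, mul_one, one_mul, mul_zero, zero_mul, add_zero, zero_add, sub_zero, zero_sub]
  simp only [h00, h03, c13, c22, c33, h00mm, scalarH, scalarHmm]
  field_simp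
  simp only [sigma, sinSq]
  ring

/-- **`g(R(∂_1,∂_2)∂_0, ∂_3)`** for the Kerr components (lowered curvature component, closed form).
[cite: KerrSchild1965, §3] -/
theorem rlow_12_03 (hu : u ∈ regularSet a) :
    bilin M a u (riemAt (bilin M a) u (E4.basisVector 1) (E4.basisVector 2) (E4.basisVector 0))
      (E4.basisVector 3) = (u 2 ^ (3 : ℕ) * M * a ^ (3 : ℕ) -
        3 * u 1 ^ (2 : ℕ) * u 2 * M * a) / sigma a u ^ (2 : ℕ) := by
  have hS := hu.1
  have hP := hu.2
  rw [(isMetricOn_bilin M a).apply_riemAt hu]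
  simp only [koszulCLM_eq_koszulForm, fderiv_koszulForm_bilin M a hu, bilin_apply,
    chrAt_bv_01 M a hu, chrAt_bv_02 M a hu, chrAt_bv_13 M a hu, chrAt_bv_23 M a hu,
    (isMetricOn_bilin M a).chrAt_comm hu (E4.basisVector 1) (E4.basisVector 0),
    (isMetricOn_bilin M a).chrAt_comm hu (E4.basisVector 2) (E4.basisVector 0)]
  simp only [dKoszulR, dKoszulM, bilinRR_apply, bilinRM_apply, bilinMM_apply, bv_apply,
    Fin.isValue, Fin.reduceEq, if_true, if_false, Matrix.cons_val_zero, Matrix.cons_val_one,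
    Matrix.cons_val, mul_one, one_mul, mul_zero, zero_mul, add_zero, zero_add, sub_zero]
  simp only [h00, h03, c13, c33, h00r, h00rm, h03rm, scalarH, scalarHr, scalarHrm]
  field_simp
  simp only [sigma, sinSq]
  ring

/-- **`g(R(∂_1,∂_2)∂_1, ∂_2)`** for the Kerr components (lowered curvature component, closed form).
[cite: KerrSchild1965, §3] -/
theorem rlow_12_12 (hu : u ∈ regularSet a) :
    bilin M a u (riemAt (bilin M a) u (E4.basisVector 1) (E4.basisVector 2) (E4.basisVector 1))
      (E4.basisVector 2) = (-(12 * u 1 * u 2 ^ (4 : ℕ) * M * a ^ (4 : ℕ)) +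
        9 * u 1 * u 2 ^ (2 : ℕ) * M * a ^ (4 : ℕ) -
        6 * u 1 ^ (2 : ℕ) * u 2 ^ (2 : ℕ) * M ^ (2 : ℕ) * a ^ (2 : ℕ) +
        u 1 ^ (3 : ℕ) * u 2 ^ (2 : ℕ) * M * a ^ (2 : ℕ) - 3 * u 1 ^ (3 : ℕ) * M * a ^ (2 : ℕ) +
        2 * u 1 ^ (4 : ℕ) * M ^ (2 : ℕ) + u 1 ^ (5 : ℕ) * M) / (sigma a u ^ (3 : ℕ) * sinSq u) := by
  have hS := hu.1
  have hP := hu.2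
  rw [(isMetricOn_bilin M a).apply_riemAt hu]
  simp only [koszulCLM_eq_koszulForm, fderiv_koszulForm_bilin M a hu, bilin_apply,
    chrAt_bv_11 M a hu, chrAt_bv_12 M a hu, chrAt_bv_22 M a hu,
    (isMetricOn_bilin M a).chrAt_comm hu (E4.basisVector 2) (E4.basisVector 1)]
  simp only [dKoszulR, dKoszulM, bilinRR_apply, bilinRM_apply, bilinMM_apply, bv_apply,
    Fin.isValue, Fin.reduceEq, if_true, if_false, Matrix.cons_val_zero, Matrix.cons_val_one,
    Matrix.cons_val, mul_one, one_mul, mul_zero, zero_mul, add_zero, zero_add, sub_zero, zero_sub]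
  simp only [h00, h03, c13, c22, c33, c22rr, h00mm, scalarH, scalarHmm]
  field_simp
  simp only [sigma, sinSq]
  ring

/-- **`g(R(∂_1,∂_2)∂_1, ∂_3)`** for the Kerr components (lowered curvature component, closed form).
[cite: KerrSchild1965, §3] -/
theorem rlow_12_13 (hu : u ∈ regularSet a) :
    bilin M a u (riemAt (bilin M a) u (E4.basisVector 1) (E4.basisVector 2) (E4.basisVector 1))
      (E4.basisVector 3) = (3 * u 2 ^ (5 : ℕ) * M * a ^ (5 : ℕ) -
        3 * u 2 ^ (3 : ℕ) * M * a ^ (5 : ℕ) -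
        9 * u 1 ^ (2 : ℕ) * u 2 ^ (3 : ℕ) * M * a ^ (3 : ℕ) +
        9 * u 1 ^ (2 : ℕ) * u 2 * M * a ^ (3 : ℕ)) / sigma a u ^ (3 : ℕ) := by
  have hS := hu.1
  have hP := hu.2
  rw [(isMetricOn_bilin M a).apply_riemAt hu]
  simp only [koszulCLM_eq_koszulForm, fderiv_koszulForm_bilin M a hu, bilin_apply,
    chrAt_bv_11 M a hu, chrAt_bv_12 M a hu, chrAt_bv_13 M a hu, chrAt_bv_23 M a hu,
    (isMetricOn_bilin M a).chrAt_comm hu (E4.basisVector 2) (E4.basisVector 1)]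
  simp only [dKoszulR, dKoszulM, bilinRR_apply, bilinRM_apply, bilinMM_apply, bv_apply,
    Fin.isValue, Fin.reduceEq, if_true, if_false, Matrix.cons_val_zero, Matrix.cons_val_one,
    Matrix.cons_val, mul_one, one_mul, mul_zero, zero_mul, add_zero, zero_add, sub_zero]
  simp only [h00, h03, c13, c22, c33, h00r, h00rm, h03rm, scalarH, scalarHr, scalarHrm]
  field_simp
  simp only [sigma, sinSq]
  ring

/-- **`g(R(∂_1,∂_2)∂_2, ∂_3)`** for the Kerr components (lowered curvature component, closed form).
[cite: KerrSchild1965, §3] -/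
theorem rlow_12_23 (hu : u ∈ regularSet a) :
    bilin M a u (riemAt (bilin M a) u (E4.basisVector 1) (E4.basisVector 2) (E4.basisVector 2))
      (E4.basisVector 3) = (-(3 * u 1 * u 2 ^ (4 : ℕ) * M * a ^ (5 : ℕ)) +
        9 * u 1 * u 2 ^ (2 : ℕ) * M * a ^ (5 : ℕ) -
        6 * u 1 ^ (2 : ℕ) * u 2 ^ (2 : ℕ) * M ^ (2 : ℕ) * a ^ (3 : ℕ) +
        7 * u 1 ^ (3 : ℕ) * u 2 ^ (2 : ℕ) * M * a ^ (3 : ℕ) -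
        3 * u 1 ^ (3 : ℕ) * M * a ^ (3 : ℕ) + 2 * u 1 ^ (4 : ℕ) * M ^ (2 : ℕ) * a -
        2 * u 1 ^ (5 : ℕ) * M * a) / sigma a u ^ (3 : ℕ) := by
  have hS := hu.1
  have hP := hu.2
  rw [(isMetricOn_bilin M a).apply_riemAt hu]
  simp only [koszulCLM_eq_koszulForm, fderiv_koszulForm_bilin M a hu, bilin_apply,
    chrAt_bv_12 M a hu, chrAt_bv_13 M a hu, chrAt_bv_22 M a hu, chrAt_bv_23 M a hu]
  simp only [dKoszulR, dKoszulM, bilinRR_apply, bilinRM_apply, bilinMM_apply, bv_apply,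
    Fin.isValue, Fin.reduceEq, if_true, if_false, Matrix.cons_val_zero, Matrix.cons_val_one,
    Matrix.cons_val, mul_one, one_mul, mul_zero, zero_mul, add_zero, zero_add, sub_zero, zero_sub]
  simp only [h00, h03, c13, c22, c33, h00m, h00mm, h03mm, scalarH, scalarHm, scalarHmm]
  field_simp
  simp only [sigma, sinSq]
  ring

end Ingoing

end Kerr

end Literature.Geometry.Lorentzian

end
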